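import Literature.AlgebraicGeometry.Resolution.NeronPopescuClearDenominatorsCore
import Literature.AlgebraicGeometry.Resolution.StandardSmoothExtend
import Literature.AlgebraicGeometry.Resolution.ScaledPresentation
import Mathlib.RingTheory.MvPolynomial.Localization
import Mathlib.RingTheory.MvPolynomial.Tower
import Mathlib.RingTheory.Localization.Integer
import Mathlib.RingTheory.Localization.Ideal
import Mathlib.Tactic.LinearCombination
import HarnessLib

/-!
# Stacks 07F4: clearing denominators in a standard smooth factorisation

Topic: `Literature/AlgebraicGeometry/Resolution`. Stacks, *Smoothing Ring Maps*, Lemma 07F4,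
for a *standard smooth* `B'` (the general smooth case reduces to this by 07CH, "We first
apply Lemma 07CH to `S⁻¹R → B'`. Thus we may assume `B'` is standard smooth over `S⁻¹R`"):

> Let `R → A → Λ` be ring maps with `A` of finite presentation over `R`. Let `S ⊂ R` be a
> multiplicative set. Let `S⁻¹A → B' → S⁻¹Λ` be a factorization with `B'` [standard] smooth over
> `S⁻¹R`. Then we can find a factorization `A → B → Λ` such that some `s ∈ S` maps to an
> elementary standard element (Definition 07C7) in `B` over `R`.

This is the hypothesis `hF4` of `Stacks07F5_reduceToField_of` (`NeronPopescuReduceToField.lean`),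
PROVED here (`exists_elementaryStandard_factorization`) following the printed proof: a
presentation `A = R[x_1, …, x_n]/(g_1, …, g_t)`; by 07EY a standard presentation of `B'`
over `S⁻¹R` whose first `n` generators are the images of the `x_i`
(`exists_submersivePresentation_fin_extend`); rescaling the other generators by elements of
`S` so that they map to `λ_i/1 ∈ S⁻¹Λ` (`exists_presentation_unit_smul`); clearing the
denominators of the relations `f_j`, of a relation `a_0 det(∂f_j/∂x_i) + ∑ a_j f_j = 1`, of
the memberships `g_k ∈ (f_1, …, f_c)S⁻¹R[x]` and of the vanishing `f_j(λ) = 0 ∈ S⁻¹Λ`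
(`MvPolynomial.isLocalization`: `S⁻¹R[x]` is the localisation of `R[x]` at `S`); and finally
the algebra `B = R[x]/(s'_j f_j, g_k)` with its elementary standard element `s_0 ∏ s_k ∏ s'_j`
(`exists_elementaryStandard_algebra`, `NeronPopescuClearDenominatorsCore.lean`).
The localisations `S⁻¹R`, `S⁻¹A`, `S⁻¹Λ` are arbitrary (`IsLocalization`). No new notions, no
named facts.

## Sources

* The Stacks Project, *Smoothing Ring Maps* (Tag 07BW), Lemma 07F4 and its proof; Lemma 07EY;
  Definition 07C7. [StacksProject]
-/

noncomputable section

open MvPolynomial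

namespace Literature.AlgebraicGeometry.Resolution

universe u

section ClearDenominators

/-- **Stacks 07F4 (for a standard smooth `B'`).** Let `R → A → Λ` with `A` finitely presented,
`S ⊆ R` multiplicative, `S⁻¹R → S⁻¹A → S⁻¹Λ` localisations of `R → A → Λ` and `φ_S` the
localised map, and let `S⁻¹A → B' → S⁻¹Λ` be a factorisation of `φ_S` with `B'` standard smooth
over `S⁻¹R`. Then there is a factorisation `A → B → Λ` of `φ` such that some `s ∈ S` is
elementary standard in `B` over `R`. [cite: StacksProject, Tag 07F4] -/
theorem exists_elementaryStandard_factorization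
    (R A Λ : Type u) [CommRing R] [CommRing A] [CommRing Λ] [Algebra R A] [Algebra R Λ]
    (φ : A →ₐ[R] Λ) [Algebra.FinitePresentation R A]
    (S : Submonoid R) (RS AS ΛS : Type u) [CommRing RS] [CommRing AS] [CommRing ΛS]
    [Algebra R RS] [IsLocalization S RS]
    [Algebra A AS] [Algebra R AS] [IsScalarTower R A AS]
    [IsLocalization (Algebra.algebraMapSubmonoid A S) AS] [Algebra RS AS] [IsScalarTower R RS AS]
    [Algebra Λ ΛS] [Algebra R ΛS] [IsScalarTower R Λ ΛS]
    [IsLocalization (Algebra.algebraMapSubmonoid Λ S) ΛS] [Algebra RS ΛS] [IsScalarTower R RS ΛS]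
    (φS : AS →ₐ[RS] ΛS) (hφS : ∀ a : A, φS (algebraMap A AS a) = algebraMap Λ ΛS (φ a))
    (B' : Type u) [CommRing B'] [Algebra RS B'] [Algebra.IsStandardSmooth RS B']
    (v' : AS →ₐ[RS] B') (w' : B' →ₐ[RS] ΛS) (hvw' : w'.comp v' = φS) :
    ∃ (B : Type u) (_ : CommRing B) (_ : Algebra R B) (v : A →ₐ[R] B) (w : B →ₐ[R] Λ),
      w.comp v = φ ∧ ∃ s ∈ S, IsElementaryStandard R (algebraMap R B s) := by
  classical
  -- `B'` as an `R`-algebra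
  letI : Algebra R B' := ((algebraMap RS B').comp (algebraMap R RS)).toAlgebra
  haveI : IsScalarTower R RS B' := IsScalarTower.of_algebraMap_eq fun _ => rfl
  -- a presentation `A = R[x_1, …, x_n]/(g_1, …, g_t)`
  obtain ⟨n, t, ⟨PA⟩⟩ := Algebra.Presentation.exists_presentation_fin R A
  -- 07EY: a standard presentation of `B'` whose first `n` generators are the images of the `x_i`
  let a : Fin n → B' := fun i => v' (algebraMap A AS (PA.val i))
  obtain ⟨N, c, hnc, hcN, P, hPa, hPmap⟩ := exists_submersivePresentation_fin_extend (R := RS) a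
  have hnN : n ≤ N := hnc.trans hcN
  -- integrality of the images of the generators in `S⁻¹Λ`
  have hsurj : ∀ i : Fin N, ∃ (l : Λ) (u : R), u ∈ S ∧
      w' (P.val i) * algebraMap R ΛS u = algebraMap Λ ΛS l := by
    intro i
    obtain ⟨⟨l, m⟩, hlm⟩ := IsLocalization.surj (Algebra.algebraMapSubmonoid Λ S) (w' (P.val i))
    obtain ⟨u, hu, hum⟩ := Submonoid.mem_map.mp m.2
    refine ⟨l, u, hu, ?_⟩
    rw [IsScalarTower.algebraMap_apply R Λ ΛS, hum]
    exact hlm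
  choose l₀ u₀ hu₀ hlu₀ using hsurj
  -- for the first `n` generators we keep `u = 1` and `λ = φ(x_i)`
  let u : Fin N → R := fun i => if (i : ℕ) < n then 1 else u₀ i
  let lam : Fin N → Λ := fun i => if h : (i : ℕ) < n then φ (PA.val ⟨i, h⟩) else l₀ i
  have hu : ∀ i, u i ∈ S := fun i => by
    by_cases h : (i : ℕ) < n
    · simp only [u, h, if_true]
      exact one_mem S
    · simp only [u, h, if_false]
      exact hu₀ i
  have hval_lt : ∀ (i : Fin N) (h : (i : ℕ) < n), P.val i = a ⟨i, h⟩ := fun i h => by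
    rw [← hPa ⟨i, h⟩]
    congr 1
  have hfin : ∀ (i : Fin n) (h : ((Fin.castLE hnN i : Fin N) : ℕ) < n),
      (⟨((Fin.castLE hnN i : Fin N) : ℕ), h⟩ : Fin n) = i := fun i h => Fin.ext rfl
  have hlam_lt : ∀ i : Fin n, lam (Fin.castLE hnN i) = φ (PA.val i) := fun i => by
    have h : ((Fin.castLE hnN i : Fin N) : ℕ) < n := i.2
    simp only [lam, h, dif_pos, hfin i h]
  have hlu : ∀ i, w' (P.val i) * algebraMap R ΛS (u i) = algebraMap Λ ΛS (lam i) := by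
    intro i
    by_cases h : (i : ℕ) < n
    · simp only [u, lam, h, if_true, dif_pos, map_one, mul_one]
      rw [hval_lt i h]
      change w' (v' (algebraMap A AS (PA.val ⟨i, h⟩))) = _
      rw [← AlgHom.comp_apply, hvw', hφS]
    · simp only [u, lam, h, if_false, dif_neg, not_false_eq_true]
      exact hlu₀ i
  -- rescale the generators by the units `u_i`
  let U : Fin N → RS := fun i => algebraMap R RS (u i)
  let V : Fin N → RS := fun i => IsLocalization.mk' RS 1 ⟨u i, hu i⟩
  have hVU : ∀ i, V i * U i = 1 := fun i => by
    change IsLocalization.mk' RS 1 ⟨u i, hu i⟩ * algebraMap R RS (u i) = 1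
    rw [IsLocalization.mk'_spec, map_one]
  have hUV : ∀ i, U i * V i = 1 := fun i => by rw [mul_comm]; exact hVU i
  obtain ⟨P', hP'val, hP'rel⟩ := exists_presentation_unit_smul P.toPresentation U V hVU
  -- images of the new generators: `λ_i/1`
  have hw'val : ∀ i, w' (P'.val i) = algebraMap Λ ΛS (lam i) := fun i => by
    rw [hP'val, map_mul, AlgHom.commutes, ← hlu, mul_comm]
    exact congrArg (w' (P.val i) * ·) (IsScalarTower.algebraMap_apply R RS ΛS (u i)).symm
  -- the first `n` new generators are still the images of the `x_i`
  have hP'val_lt : ∀ i : Fin n, P'.val (Fin.castLE hnN i) = a i := fun i => by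
    have h : ((Fin.castLE hnN i : Fin N) : ℕ) < n := i.2
    rw [hP'val, hval_lt _ h, hfin i h]
    simp only [U, u, h, if_true, map_one, one_mul]
  -- the Jacobian minor of the new relations with respect to the first `c` variables is a unit
  set θ : MvPolynomial (Fin N) RS →ₐ[RS] MvPolynomial (Fin N) RS := aeval fun k => C (V k) * X k
    with hθ
  have hθval : ∀ q, aeval P'.val (θ q) = aeval P.val q := fun q => by
    have hfun : (fun i => algebraMap RS B' (U i) * P.toPresentation.val i) = P'.val :=
      funext fun i => (hP'val i).symm
    rw [← AlgHom.comp_apply, ← hfun, aeval_smul_comp_aeval_C_mul_X P.toPresentation.val U V hVU]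
  have hrelθ : P'.relation = fun j => θ (P.relation j) := funext hP'rel
  have hunit' : IsUnit (aeval P'.val (jacobianMinor P'.relation le_rfl (Fin.castLE hcN))) := by
    rw [hrelθ]
    unfold jacobianMinor
    rw [det_pderiv_aeval_C_mul_X, map_mul, hθval]
    refine IsUnit.mul (IsUnit.map _ ?_) ?_
    · refine IsUnit.of_mul_eq_one (∏ i : Fin c, C (U (Fin.castLE hcN i))) ?_
      rw [← Finset.prod_mul_distrib]
      simp only [← map_mul, hVU, map_one, Finset.prod_const_one]
    · have hM : (Matrix.of fun i j : Fin c =>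
          pderiv (Fin.castLE hcN i) (P.toPresentation.relation (Fin.castLE le_rfl j))) =
            P.jacobiMatrix := by
        refine Matrix.ext fun i j => ?_
        rw [Matrix.of_apply, P.jacobiMatrix_apply, hPmap]
        rfl
      rw [hM, ← P.algebraMap_apply, ← P.jacobian_eq_jacobiMatrix_det]
      exact P.jacobian_isUnit
  -- `S⁻¹R[x]` is the localisation of `R[x]` at `S`
  letI : Algebra (MvPolynomial (Fin N) R) (MvPolynomial (Fin N) RS) := MvPolynomial.algebraMvPolynomial
  haveI : IsLocalization (S.map (C : R →+* MvPolynomial (Fin N) R)) (MvPolynomial (Fin N) RS) :=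
    MvPolynomial.isLocalization S RS
  have hamap : ∀ q : MvPolynomial (Fin N) R,
      algebraMap (MvPolynomial (Fin N) R) (MvPolynomial (Fin N) RS) q = MvPolynomial.map (algebraMap R RS) q :=
    fun q => rfl
  -- clear the denominators of the relations: `f_j ∈ R[x]` with `f_j = d_j · (relation j)`, `d_j ∈ S`
  have hrelint : ∀ j : Fin c, ∃ (G : MvPolynomial (Fin N) R) (d : R), d ∈ S ∧
      MvPolynomial.map (algebraMap R RS) G = C (algebraMap R RS d) * P'.relation j := by
    intro j
    obtain ⟨⟨G, m⟩, hGm⟩ := IsLocalization.surj (S.map (C : R →+* MvPolynomial (Fin N) R)) (P'.relation j)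
    obtain ⟨d, hd, hdm⟩ := Submonoid.mem_map.mp m.2
    refine ⟨G, d, hd, ?_⟩
    rw [← hamap, ← hGm, ← hdm, hamap, map_C, mul_comm]
  choose f d hdS hfd using hrelint
  have hdunit : ∀ j, IsUnit (C (σ := Fin N) (algebraMap R RS (d j))) := fun j =>
    IsUnit.map C (IsLocalization.map_units RS ⟨d j, hdS j⟩)
  -- the `f_j` generate the kernel of `S⁻¹R[x] → B'`
  have hspan : Ideal.span (Set.range fun j => MvPolynomial.map (algebraMap R RS) (f j)) =
      RingHom.ker (aeval (R := RS) P'.val) := by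
    have h1 : (fun j => MvPolynomial.map (algebraMap R RS) (f j)) =
        fun j => C (algebraMap R RS (d j)) * P'.relation j := funext hfd
    rw [h1, span_range_unit_mul_eq _ _ hdunit, P'.span_range_relation_eq_ker, P'.ker_eq_ker_aeval_val]
  have hfker : ∀ j, aeval P'.val (MvPolynomial.map (algebraMap R RS) (f j)) = 0 := fun j => by
    rw [← RingHom.mem_ker, ← hspan]
    exact Ideal.subset_span ⟨j, rfl⟩
  -- and their Jacobian minor is a unit in `B'`
  have hunit : IsUnit (aeval P'.val (MvPolynomial.map (algebraMap R RS)
      (jacobianMinor f le_rfl (Fin.castLE hcN)))) := by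
    rw [← jacobianMinor_map]
    have h1 : (fun j => MvPolynomial.map (algebraMap R RS) (f j)) =
        fun j => C (algebraMap R RS (d j)) * P'.relation j := funext hfd
    rw [h1, jacobianMinor_C_mul, map_mul]
    refine IsUnit.mul (IsUnit.map _ (IsUnit.map _ ?_)) hunit'
    exact IsUnit.prod_univ_iff.mpr fun j => IsLocalization.map_units RS ⟨d _, hdS _⟩
  -- (d): `a_0 det(∂f_j/∂x_i) + Σ a_j f_j = s_0` in `R[x]`
  set D : MvPolynomial (Fin N) R := jacobianMinor f le_rfl (Fin.castLE hcN) with hD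
  have hd_step : ∃ (s₀ : R) (_ : s₀ ∈ S) (a₀ : MvPolynomial (Fin N) R) (av : Fin c → MvPolynomial (Fin N) R),
      a₀ * D + ∑ j, av j * f j = C s₀ := by
    obtain ⟨b₀, hb₀⟩ := hunit.exists_left_inv
    obtain ⟨q₀, hq₀⟩ := P'.aeval_val_surjective b₀
    obtain ⟨⟨Q₀, mq⟩, hQ₀⟩ :=
      IsLocalization.surj (S.map (C : R →+* MvPolynomial (Fin N) R)) (S := MvPolynomial (Fin N) RS) q₀
    obtain ⟨sq, hsqS, hsq⟩ := Submonoid.mem_map.mp mq.2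
    -- `map (Q₀ D - sq) ∈ (f) S⁻¹R[x]`
    have hmem : algebraMap _ (MvPolynomial (Fin N) RS) (Q₀ * D - C sq) ∈
        (Ideal.span (Set.range f)).map (algebraMap _ (MvPolynomial (Fin N) RS)) := by
      rw [Ideal.map_span, ← Set.range_comp]
      change _ ∈ Ideal.span (Set.range fun j => algebraMap _ (MvPolynomial (Fin N) RS) (f j))
      simp_rw [hamap]
      rw [hspan, RingHom.mem_ker, map_sub, map_mul]
      have hQ : MvPolynomial.map (algebraMap R RS) Q₀ = q₀ * C (algebraMap R RS sq) := by
        rw [← hamap, ← hQ₀, ← hsq, hamap, map_C]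
      rw [hQ, map_sub, map_mul, map_mul, hq₀, algHom_C, mul_right_comm, hb₀, one_mul, map_C, algHom_C,
        sub_self]
    obtain ⟨⟨⟨y, hy⟩, m⟩, hym⟩ :=
      (IsLocalization.mem_map_algebraMap_iff (S.map (C : R →+* MvPolynomial (Fin N) R))
        (MvPolynomial (Fin N) RS)).mp hmem
    obtain ⟨sm, hsmS, hsm⟩ := Submonoid.mem_map.mp m.2
    have hzero : algebraMap _ (MvPolynomial (Fin N) RS) ((Q₀ * D - C sq) * C sm - y) = 0 := by
      rw [map_sub, map_mul, hsm, sub_eq_zero]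
      exact hym
    obtain ⟨⟨m', hm'⟩, hm'zero⟩ :=
      (IsLocalization.map_eq_zero_iff (S.map (C : R →+* MvPolynomial (Fin N) R))
        (MvPolynomial (Fin N) RS) _).mp hzero
    obtain ⟨sm', hsm'S, hsm'⟩ := Submonoid.mem_map.mp hm'
    have key : C sm' * ((Q₀ * D - C sq) * C sm - y) = 0 := by
      rw [hsm']
      exact hm'zero
    obtain ⟨av, hav⟩ := Ideal.mem_span_range_iff_exists_fun.mp (Ideal.mul_mem_left _ (C sm') hy)
    refine ⟨sm' * sm * sq, S.mul_mem (S.mul_mem hsm'S hsmS) hsqS, C (sm' * sm) * Q₀,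
      fun j => -av j, ?_⟩
    rw [map_mul, map_mul, map_mul]
    have hsum : ∑ j, -av j * f j = -(C sm' * y) := by
      rw [← hav, ← Finset.sum_neg_distrib]
      exact Finset.sum_congr rfl fun j _ => by ring
    rw [hsum]
    linear_combination key
  obtain ⟨s₀, hs₀S, a₀, av, hda⟩ := hd_step
  -- (e): `s_k g_k ∈ (f_1, …, f_c)` in `R[x]`
  have he_step : ∀ k : Fin t, ∃ (sk : R) (_ : sk ∈ S),
      C sk * rename (Fin.castLE hnN) (PA.relation k) ∈ Ideal.span (Set.range f) := by
    intro k
    -- `g_k` maps to zero in `B'`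
    have hgk : aeval P'.val (MvPolynomial.map (algebraMap R RS) (rename (Fin.castLE hnN) (PA.relation k))) = 0 := by
      rw [aeval_map_algebraMap, aeval_rename]
      have hcomp : (fun i : Fin n => P'.val (Fin.castLE hnN i)) =
          fun i => ((v'.restrictScalars R).comp (IsScalarTower.toAlgHom R A AS)) (PA.val i) := by
        funext i
        rw [hP'val_lt]
        rfl
      change aeval (fun i : Fin n => P'.val (Fin.castLE hnN i)) (PA.relation k) = 0
      rw [hcomp, ← comp_aeval_apply, PA.aeval_val_relation, map_zero]
    have hmem : algebraMap _ (MvPolynomial (Fin N) RS) (rename (Fin.castLE hnN) (PA.relation k)) ∈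
        (Ideal.span (Set.range f)).map (algebraMap _ (MvPolynomial (Fin N) RS)) := by
      rw [Ideal.map_span, ← Set.range_comp]
      change _ ∈ Ideal.span (Set.range fun j => algebraMap _ (MvPolynomial (Fin N) RS) (f j))
      simp_rw [hamap]
      rw [hspan, RingHom.mem_ker]
      exact hgk
    obtain ⟨⟨⟨y, hy⟩, m⟩, hym⟩ :=
      (IsLocalization.mem_map_algebraMap_iff (S.map (C : R →+* MvPolynomial (Fin N) R))
        (MvPolynomial (Fin N) RS)).mp hmem
    obtain ⟨sm, hsmS, hsm⟩ := Submonoid.mem_map.mp m.2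
    have hzero : algebraMap _ (MvPolynomial (Fin N) RS)
        (rename (Fin.castLE hnN) (PA.relation k) * C sm - y) = 0 := by
      rw [map_sub, map_mul, hsm, sub_eq_zero]
      exact hym
    obtain ⟨⟨m', hm'⟩, hm'zero⟩ :=
      (IsLocalization.map_eq_zero_iff (S.map (C : R →+* MvPolynomial (Fin N) R))
        (MvPolynomial (Fin N) RS) _).mp hzero
    obtain ⟨sm', hsm'S, hsm'⟩ := Submonoid.mem_map.mp hm'
    refine ⟨sm' * sm, S.mul_mem hsm'S hsmS, ?_⟩
    have key : C sm' * (rename (Fin.castLE hnN) (PA.relation k) * C sm - y) = 0 := by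
      rw [hsm']
      exact hm'zero
    have heq : C (sm' * sm) * rename (Fin.castLE hnN) (PA.relation k) = C sm' * y := by
      rw [map_mul]
      linear_combination key
    rw [heq]
    exact Ideal.mul_mem_left _ _ hy
  choose sk hskS hsk using he_step
  -- (f): `s'_j f_j(λ) = 0` in `Λ`
  have hf_step : ∀ j : Fin c, ∃ (s'j : R) (_ : s'j ∈ S), algebraMap R Λ s'j * aeval lam (f j) = 0 := by
    intro j
    have h1 : algebraMap Λ ΛS (aeval lam (f j)) = 0 := by
      have h2 : w' (aeval P'.val (MvPolynomial.map (algebraMap R RS) (f j))) = 0 := by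
        rw [hfker, map_zero]
      rw [aeval_map_algebraMap] at h2
      change (w'.restrictScalars R) (aeval P'.val (f j)) = 0 at h2
      rw [comp_aeval_apply] at h2
      have hfun : (fun i => (w'.restrictScalars R) (P'.val i)) =
          fun i => (IsScalarTower.toAlgHom R Λ ΛS) (lam i) := funext fun i => hw'val i
      rw [hfun, ← comp_aeval_apply] at h2
      exact h2
    obtain ⟨⟨m, hm⟩, hmzero⟩ :=
      (IsLocalization.map_eq_zero_iff (Algebra.algebraMapSubmonoid Λ S) ΛS _).mp h1
    obtain ⟨s'j, hs'jS, hs'j⟩ := Submonoid.mem_map.mp hm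
    exact ⟨s'j, hs'jS, by rw [hs'j]; exact hmzero⟩
  choose s' hs'S hs' using hf_step
  -- (g): `g_k(λ_1, …, λ_n) = 0`
  have hg : ∀ k, aeval (lam ∘ Fin.castLE hnN) (PA.relation k) = 0 := fun k => by
    have hfun : lam ∘ Fin.castLE hnN = fun i => φ (PA.val i) := funext hlam_lt
    rw [hfun, ← comp_aeval_apply, PA.aeval_val_relation, map_zero]
  -- the algebra `B`
  obtain ⟨B, _, _, x, w, hwx, hgx, hel⟩ := exists_elementaryStandard_algebra hcN hnN f PA.relation
    lam s₀ sk s' ⟨a₀, av, hda⟩ hsk hs' hg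
  -- the map `A → B`
  have hkerle : PA.ker ≤ RingHom.ker (aeval (x ∘ Fin.castLE hnN) : MvPolynomial (Fin n) R →ₐ[R] B) := by
    rw [← PA.span_range_relation_eq_ker, Ideal.span_le]
    rintro _ ⟨k, rfl⟩
    rw [SetLike.mem_coe, RingHom.mem_ker]
    exact hgx k
  let v₀ : PA.Quotient →ₐ[R] B :=
    Ideal.Quotient.liftₐ PA.ker (aeval (x ∘ Fin.castLE hnN)) fun p hp => hkerle hp
  let v : A →ₐ[R] B := v₀.comp (PA.quotientEquiv.restrictScalars R).symm.toAlgHom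
  have hv : ∀ p : MvPolynomial (Fin n) R, v (aeval PA.val p) = aeval (x ∘ Fin.castLE hnN) p := by
    intro p
    have h1 : (PA.quotientEquiv.restrictScalars R).symm (aeval PA.val p) = Ideal.Quotient.mk PA.ker p := by
      rw [AlgEquiv.symm_apply_eq]
      change _ = PA.quotientEquiv (Ideal.Quotient.mk PA.ker p)
      rw [PA.quotientEquiv_mk, PA.algebraMap_apply]
    change v₀ ((PA.quotientEquiv.restrictScalars R).symm (aeval PA.val p)) = _
    rw [h1]
    rfl
  refine ⟨B, inferInstance, inferInstance, v, w, ?_, s₀ * (∏ k, sk k) * ∏ j, s' j, ?_, hel⟩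
  · refine AlgHom.ext fun y => ?_
    obtain ⟨p, rfl⟩ := PA.aeval_val_surjective y
    have hfun : (fun i => w ((x ∘ Fin.castLE hnN) i)) = fun i => φ (PA.val i) :=
      funext fun i => by
        change w (x (Fin.castLE hnN i)) = _
        rw [hwx, hlam_lt]
    rw [AlgHom.comp_apply, hv, comp_aeval_apply, hfun, ← comp_aeval_apply]
  · exact S.mul_mem (S.mul_mem hs₀S (prod_mem fun k _ => hskS k)) (prod_mem fun j _ => hs'S j)

end ClearDenominators

end Literature.AlgebraicGeometry.Resolution

end
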